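import Summits.BirchSwinnertonDyer.Rank1Residual.Additive.X3BranchLayerOneCubicResidues
import Mathlib.RingTheory.Polynomial.Cyclotomic.Roots
import HarnessLib

/-!
# X3, the DEGENERATE rows OFF the sub-locus: STEP 4 of the independence argument for the layer
# T-side classes — a relation `∏ bᵢ^{dᵢ} = ζ₉^c · γ³` in `ℚ(ζ₉)` with `γ ∈ ℚ[ζ₉]` and a CUBIC-RESIDUE
# CERTIFICATE at primes `q ≡ 1 (mod 27)` forces `d = 0` (cell `bsd-eis`, seat `bsd-eis-x3` gen 8;
# the `ℤ[ζ₉]` analogue of gen 7's `KummerLayerClasses.eq_zero_of_cube_eq_prod_layerOne`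
# (`X3BranchLayerOneCubicResidues.lean`); MEMO-9 §2.4 (f); route K1 `AdditiveBranchIMC`, crux
# `GordTwoRankZeroOffCaseOne` — supports only)

HONEST FRAMING (`run/shared/lean/pub/bsd-eis/README.md` §4): THEOREMS ONLY (no `def`, no named fact,
no `sorry`); nothing is booked; no label, tier or count of record moves.

## What

`ζ` a primitive `9`-th root of unity in a field `F` of characteristic `0`; radicands
`bᵢ = Σ_{k<6} b_{ik} ζ^k ∈ ℤ[ζ]`; a relation `∏ bᵢ^{dᵢ} = ζ^c · G(ζ)³` (`d ∈ 𝔽₃^ι`, `c ∈ ℕ`,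
`G ∈ ℚ[X]` — the output of STEP 3, `LayerCharTower.exists_eq_zeta27_pow_mul_aeval`, cubed).
CERTIFICATE: primes `q_ρ` with `27 ∣ q_ρ − 1`, the six roots `r_{ρ,k}` of `X⁶ + X³ + 1 (mod q_ρ)` with a
Vandermonde inverse `w_ρ`, `ω_ρ` of order `3`, exponents `bᵢ(r_{ρ,0})^{(q_ρ−1)/3} = ω_ρ^{e_{ρ,i}}`
(`bᵢ(r_{ρ,0}) ≠ 0`), and a left inverse `L` of `e` modulo `3`. THEN `d = 0`
(`eq_zero_of_prod_eq_zeta9_pow_mul_cube`): minimal denominator `m·G(ζ) ∈ ℤ[ζ]`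
(`exists_intSextuple_of_aeval`), transfer of `m³∏bᵢ^{dᵢ} = ζ^c (mG(ζ))³` to `𝔽_q` at every root
(`eval₂_eq_of_aeval_eq_zeta9`: `Φ₉ = minpoly_ℤ ζ` divides the difference), `q ∤ m` by Vandermonde and
minimality, and — because `27 ∣ q − 1` makes `r_{ρ,0}` (of order `9`) a CUBE — Fermat gives
`Σᵢ e_{ρ,i} dᵢ ≡ 0 (mod 3)`, whence `d = L·(e·d) = 0`.
* tools: `pow_nine_eq_one_of_rel`, `coeffs_eq_zero_of_vandermondeN`, `pow_div_three_eq_one_of_zeta`,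
  `eval₂_eq_of_aeval_eq_zeta9`, `exists_intSextuple_of_aeval`.
References: [IrelandRosen1990] Ch. 9 §1 (cubic residue character); [Washington1997] §2, §13.1.
-/

set_option autoImplicit false

noncomputable section

open scoped Classical

namespace Summit.BirchSwinnertonDyer.Rank1Residual.Additive

namespace KummerLayerTwisted

open Polynomial Finset

/-! ### §1 Tools -/

/-- `r⁶ + r³ + 1 = 0 ⟹ r⁹ = 1` (`X⁹ − 1 = (X³ − 1)(X⁶ + X³ + 1)`). [folklore] -/
theorem pow_nine_eq_one_of_rel {S : Type*} [CommRing S] {r : S} (hr : r ^ 6 + r ^ 3 + 1 = 0) :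
    r ^ 9 = 1 := by
  linear_combination (r ^ 3 - 1) * hr

/-- **The Vandermonde step, `N` nodes**: a polynomial of degree `< N` over `𝔽_q` vanishing at the `N`
nodes of an invertible Vandermonde system is zero. [folklore] -/
theorem coeffs_eq_zero_of_vandermondeN {q N : ℕ} (r : Fin N → ZMod q) (w : Fin N → Fin N → ZMod q)
    (hw : ∀ a a' : Fin N, ∑ k, w a k * r k ^ a'.val = if a = a' then 1 else 0)
    (g : Fin N → ZMod q) (hg : ∀ k, ∑ a, g a * r k ^ a.val = 0) : ∀ a, g a = 0 := by
  intro a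
  have key : ∑ k, w a k * (∑ a', g a' * r k ^ a'.val) = g a := by
    calc ∑ k, w a k * (∑ a', g a' * r k ^ a'.val)
        = ∑ a', (∑ k, w a k * r k ^ a'.val) * g a' := by
          simp_rw [Finset.mul_sum, Finset.sum_mul]
          rw [Finset.sum_comm]
          exact Finset.sum_congr rfl fun a' _ ↦ Finset.sum_congr rfl fun k _ ↦ by ring
      _ = ∑ a', (if a = a' then 1 else 0) * g a' := by simp_rw [hw]
      _ = g a := by simp
  rw [← key]
  simp [hg]

/-- **Cubic residues with a `ζ₉`-factor**: in `𝔽_q` with `27 ∣ q − 1`, if `m³·x = r^c·g³` with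
`m ≠ 0`, `x ≠ 0`, `r⁹ = 1`, then `x^{(q−1)/3} = 1` (`r` has order dividing `9 ∣ (q−1)/3`, so its
contribution `r^{c(q−1)/3}` is `1`; then Fermat). [cite: IrelandRosen1990, Ch. 9 §1 (method)] -/
theorem pow_div_three_eq_one_of_zeta {q : ℕ} [hq : Fact q.Prime] (hq27 : 27 ∣ q - 1)
    {m x r g : ZMod q} (hm : m ≠ 0) (hx : x ≠ 0) (hr9 : r ^ 9 = 1) {c : ℕ}
    (h : m ^ 3 * x = r ^ c * g ^ 3) : x ^ ((q - 1) / 3) = 1 := by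
  obtain ⟨t, ht⟩ := hq27
  have h3 : (q - 1) / 3 = 9 * t := by rw [ht]; omega
  have hq1 : q - 1 = 3 * (9 * t) := by rw [ht]; ring
  have hg : g ≠ 0 := by
    intro hg0
    rw [hg0, zero_pow three_ne_zero, mul_zero, mul_eq_zero] at h
    rcases h with h0 | h0
    · exact hm (pow_eq_zero_iff three_ne_zero |>.mp h0)
    · exact hx h0
  have hmF : m ^ (q - 1) = 1 := ZMod.pow_card_sub_one_eq_one hm
  have hgF : g ^ (q - 1) = 1 := ZMod.pow_card_sub_one_eq_one hg
  have e1 : (m ^ 3 * x) ^ (9 * t) = m ^ (q - 1) * x ^ (9 * t) := by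
    rw [mul_pow, ← pow_mul, ← hq1]
  have e2 : (r ^ c * g ^ 3) ^ (9 * t) = (r ^ 9) ^ (c * t) * g ^ (q - 1) := by
    rw [mul_pow, ← pow_mul, ← pow_mul, ← pow_mul, ← hq1, show c * (9 * t) = 9 * (c * t) by ring]
  have key : m ^ (q - 1) * x ^ (9 * t) = (r ^ 9) ^ (c * t) * g ^ (q - 1) := by rw [← e1, ← e2, h]
  rw [hmF, hgF, hr9, one_pow, one_mul, one_mul] at key
  rw [h3]; exact key

/-- **Transfer modulo `q` for `ℤ[ζ₉]`**: if `P(ζ) = Q(ζ)` for integer polynomials `P, Q` and a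
primitive `9`-th root of unity `ζ` (characteristic `0`), then `P(r) = Q(r)` in any commutative ring at
any `r` with `r⁶ + r³ + 1 = 0` (`Φ₉ = minpoly_ℤ ζ` divides `P − Q`). [cite: Washington1997, §2] -/
theorem eval₂_eq_of_aeval_eq_zeta9 {F : Type*} [Field F] [CharZero F] {ζ : F}
    (hζ : IsPrimitiveRoot ζ 9) {P Q : ℤ[X]} (h : aeval ζ P = aeval ζ Q) {S : Type*} [CommRing S]
    (r : S) (hr : r ^ 6 + r ^ 3 + 1 = 0) :
    P.eval₂ (Int.castRingHom S) r = Q.eval₂ (Int.castRingHom S) r := by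
  have h0 : aeval ζ (P - Q) = 0 := by rw [map_sub, h, sub_self]
  have hint : IsIntegral ℤ ζ := hζ.isIntegral (by norm_num)
  have hdvd : minpoly ℤ ζ ∣ P - Q := minpoly.isIntegrallyClosed_dvd hint h0
  rw [← cyclotomic_eq_minpoly hζ (by norm_num)] at hdvd
  obtain ⟨W, hW⟩ := hdvd
  have hcyc : (cyclotomic 9 ℤ).eval₂ (Int.castRingHom S) r = 0 := by
    rw [show (9 : ℕ) = 3 ^ (1 + 1) by norm_num, cyclotomic_prime_pow_eq_geom_sum Nat.prime_three,
      eval₂_finsetSum]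
    simp only [Finset.sum_range_succ, Finset.sum_range_zero, eval₂_pow, eval₂_X, pow_one]
    linear_combination hr
  have e : (P - Q).eval₂ (Int.castRingHom S) r = 0 := by rw [hW, eval₂_mul, hcyc, zero_mul]
  rwa [eval₂_sub, sub_eq_zero] at e

/-- **An element of `ℚ[ζ₉]` has an integer sextuple representation with a denominator**: for
`G ∈ ℚ[X]` there are `m ≥ 1` and `g ∈ ℤ⁶` with `m·G(ζ) = Σ_{k<6} g_k ζ^k` (reduce `G` modulo `Φ₉`,
clear denominators). [cite: Washington1997, §2] -/
theorem exists_intSextuple_of_aeval {F : Type*} [Field F] [CharZero F] [Algebra ℚ F] {ζ : F}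
    (hζ : IsPrimitiveRoot ζ 9) (G : ℚ[X]) :
    ∃ m : ℕ, 0 < m ∧ ∃ g : Fin 6 → ℤ,
      (m : F) * aeval ζ G = ∑ k : Fin 6, (g k : F) * ζ ^ (k : ℕ) := by
  set Φ : ℚ[X] := cyclotomic 9 ℚ with hΦ
  have hΦm : Φ.Monic := cyclotomic.monic 9 ℚ
  have hΦζ : aeval ζ Φ = 0 := by
    rw [hΦ, aeval_def, ← eval_map, map_cyclotomic]
    exact hζ.isRoot_cyclotomic (by norm_num)
  set G' : ℚ[X] := G %ₘ Φ with hG'def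
  have hG' : aeval ζ G' = aeval ζ G := by
    rw [hG'def, modByMonic_eq_sub_mul_div G Φ, map_sub, map_mul, hΦζ, zero_mul, sub_zero]
  have hdeg : G'.natDegree < 6 := by
    have hne : Φ ≠ 1 := by
      intro h1
      have := congrArg natDegree h1
      rw [hΦ, natDegree_cyclotomic, natDegree_one] at this
      exact absurd this (by decide)
    have h := natDegree_modByMonic_lt G hΦm hne
    rwa [hΦ, natDegree_cyclotomic, show Nat.totient 9 = 6 by decide] at h
  -- the six coefficients and the common denominator
  set cf : Fin 6 → ℚ := fun k ↦ G'.coeff k with hcf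
  set m : ℕ := ∏ k : Fin 6, (cf k).den with hm
  have hm0 : 0 < m := Finset.prod_pos fun k _ ↦ (cf k).den_pos
  have hdvd : ∀ k : Fin 6, (cf k).den ∣ m := fun k ↦
    Finset.dvd_prod_of_mem (fun k ↦ (cf k).den) (Finset.mem_univ k)
  refine ⟨m, hm0, fun k ↦ ((m / (cf k).den : ℕ) : ℤ) * (cf k).num, ?_⟩
  rw [← hG', aeval_eq_sum_range' hdeg, Finset.sum_range (fun i ↦ G'.coeff i • ζ ^ i),
    Finset.mul_sum]
  refine Finset.sum_congr rfl fun k _ ↦ ?_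
  rw [Algebra.smul_def, ← mul_assoc]
  congr 1
  have hq : ((m : ℚ)) * cf k = (((m / (cf k).den : ℕ) : ℤ) * (cf k).num : ℤ) := by
    obtain ⟨t, ht⟩ := hdvd k
    rw [ht, Nat.mul_div_cancel_left _ (cf k).den_pos]
    push_cast
    rw [mul_comm ((cf k).den : ℚ) (t : ℚ), mul_assoc, Rat.den_mul_eq_num]
  calc (m : F) * algebraMap ℚ F (G'.coeff k)
      = algebraMap ℚ F ((m : ℚ) * cf k) := by rw [map_mul, map_natCast]
    _ = algebraMap ℚ F ((((m / (cf k).den : ℕ) : ℤ) * (cf k).num : ℤ) : ℚ) := by rw [hq]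
    _ = ((((m / (cf k).den : ℕ) : ℤ) * (cf k).num : ℤ) : F) := by rw [map_intCast]

/-! ### §2 The independence certificate in `ℤ[ζ₉]` -/

/-- **Independence modulo cubes in `ℚ(ζ₉)`, by cubic residues (STEP 4 of F5).** See the module
docstring. [cite: IrelandRosen1990, Ch. 9 §1 (cubic residue character)] [cite: Washington1997, §13.1] -/
theorem eq_zero_of_prod_eq_zeta9_pow_mul_cube {F : Type*} [Field F] [CharZero F] [Algebra ℚ F]
    {ζ : F} (hζ : IsPrimitiveRoot ζ 9) {ι : Type} [Fintype ι] [DecidableEq ι]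
    (b : ι → Fin 6 → ℤ) {d : ι → ZMod 3} {c : ℕ} {G : ℚ[X]}
    (hrel : ∏ i, (∑ k : Fin 6, (b i k : F) * ζ ^ (k : ℕ)) ^ (d i).val =
      ζ ^ c * (aeval ζ G) ^ 3)
    {R : ℕ} (q : Fin R → ℕ) (hq : ∀ ρ, (q ρ).Prime) (hq27 : ∀ ρ, 27 ∣ q ρ - 1)
    (r : (ρ : Fin R) → Fin 6 → ZMod (q ρ)) (hr : ∀ ρ k, r ρ k ^ 6 + r ρ k ^ 3 + 1 = 0)
    (w : (ρ : Fin R) → Fin 6 → Fin 6 → ZMod (q ρ))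
    (hw : ∀ ρ (a a' : Fin 6), ∑ k, w ρ a k * r ρ k ^ a'.val = if a = a' then 1 else 0)
    (ω : (ρ : Fin R) → ZMod (q ρ)) (hω : ∀ ρ, ω ρ ^ 3 = 1 ∧ ω ρ ≠ 1)
    (e : Fin R → ι → ℕ)
    (he : ∀ ρ i, (∑ k : Fin 6, (b i k : ZMod (q ρ)) * r ρ 0 ^ (k : ℕ)) ^ ((q ρ - 1) / 3) =
      ω ρ ^ e ρ i)
    (hnz : ∀ ρ i, (∑ k : Fin 6, (b i k : ZMod (q ρ)) * r ρ 0 ^ (k : ℕ)) ≠ 0)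
    (L : ι → Fin R → ℤ)
    (hL : ∀ i i', (∑ ρ, (L i ρ : ZMod 3) * (e ρ i' : ZMod 3)) = if i = i' then 1 else 0) :
    d = 0 := by
  haveI : ∀ ρ, Fact (q ρ).Prime := fun ρ ↦ ⟨hq ρ⟩
  set γ : F := aeval ζ G with hγdef
  -- minimal denominator `m γ ∈ ℤ[ζ]`
  have hex : ∃ m : ℕ, 0 < m ∧ ∃ g : Fin 6 → ℤ,
      (m : F) * γ = ∑ k : Fin 6, (g k : F) * ζ ^ (k : ℕ) := exists_intSextuple_of_aeval hζ G
  set m := Nat.find hex with hmdef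
  obtain ⟨hm0, g, hmγ⟩ := Nat.find_spec hex
  rw [← hmdef] at hm0 hmγ
  have hmin : ∀ m' : ℕ, m' < m → ¬ (0 < m' ∧ ∃ g : Fin 6 → ℤ,
      (m' : F) * γ = ∑ k : Fin 6, (g k : F) * ζ ^ (k : ℕ)) := fun m' hm' ↦ Nat.find_min hex hm'
  -- the polynomial identity `m³ ∏ Bᵢ^{dᵢ} = X^c G₁³` through `ζ`
  set Bp : ι → ℤ[X] := fun i ↦ ∑ k : Fin 6, C (b i k) * X ^ (k : ℕ) with hBp
  set Gp : ℤ[X] := ∑ k : Fin 6, C (g k) * X ^ (k : ℕ) with hGp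
  have haevalB : ∀ i, aeval ζ (Bp i) = ∑ k : Fin 6, (b i k : F) * ζ ^ (k : ℕ) := fun i ↦ by
    simp only [hBp, map_sum, map_mul, map_pow, aeval_C, aeval_X]
    simp only [eq_intCast]
  have haevalG : aeval ζ Gp = (m : F) * γ := by
    rw [hmγ]
    simp only [hGp, map_sum, map_mul, map_pow, aeval_C, aeval_X]
    simp only [eq_intCast]
  have hident : aeval ζ (((m : ℕ) : ℤ[X]) ^ 3 * ∏ i, Bp i ^ (d i).val) =
      aeval ζ (X ^ c * Gp ^ 3) := by
    rw [map_mul, map_pow, map_natCast, map_prod, map_mul, map_pow, map_pow, aeval_X, haevalG]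
    simp_rw [map_pow, haevalB]
    rw [hrel]; ring
  -- transfer to `𝔽_q` at a root `r`
  have htransfer : ∀ ρ (kk : Fin 6), ((m : ZMod (q ρ))) ^ 3 *
      ∏ i, (∑ k : Fin 6, (b i k : ZMod (q ρ)) * r ρ kk ^ (k : ℕ)) ^ (d i).val =
      r ρ kk ^ c * (∑ k : Fin 6, (g k : ZMod (q ρ)) * r ρ kk ^ (k : ℕ)) ^ 3 := by
    intro ρ kk
    have e := eval₂_eq_of_aeval_eq_zeta9 hζ hident (r ρ kk) (hr ρ kk)
    simp only [eval₂_mul, eval₂_finsetProd, eval₂_pow, eval₂_natCast, hBp, hGp, eval₂_finsetSum,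
      eval₂_C, eval₂_X] at e
    simp only [eq_intCast] at e
    exact e
  have hr9 : ∀ ρ kk, r ρ kk ^ 9 = 1 := fun ρ kk ↦ pow_nine_eq_one_of_rel (hr ρ kk)
  have hr0 : ∀ ρ kk, r ρ kk ≠ 0 := fun ρ kk h0 ↦ by
    have := hr9 ρ kk
    rw [h0, zero_pow (by norm_num)] at this
    exact zero_ne_one this
  -- `q ∤ m`
  have hqm : ∀ ρ, ((m : ZMod (q ρ))) ≠ 0 := by
    intro ρ hm0'
    -- `G₁(r_kk) = 0` at the six roots
    have hG0 : ∀ kk : Fin 6, (∑ k : Fin 6, (g k : ZMod (q ρ)) * r ρ kk ^ (k : ℕ)) = 0 := by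
      intro kk
      have e := htransfer ρ kk
      rw [hm0', zero_pow three_ne_zero, zero_mul] at e
      have e' := (mul_eq_zero.mp e.symm).resolve_left (pow_ne_zero _ (hr0 ρ kk))
      exact pow_eq_zero_iff three_ne_zero |>.mp e'
    -- Vandermonde ⟹ `q ∣ g_k`
    have hg : ∀ a : Fin 6, ((g a : ZMod (q ρ))) = 0 :=
      coeffs_eq_zero_of_vandermondeN (r ρ) (w ρ) (hw ρ) (fun a ↦ (g a : ZMod (q ρ))) hG0
    have hdvd : ∀ a : Fin 6, (q ρ : ℤ) ∣ g a := fun a ↦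
      (ZMod.intCast_zmod_eq_zero_iff_dvd _ _).mp (hg a)
    have hdvdm : (q ρ : ℕ) ∣ m := (ZMod.natCast_eq_zero_iff _ _).mp hm0'
    choose g' hg' using hdvd
    obtain ⟨m', hm'⟩ := hdvdm
    have hqpos : 0 < q ρ := (hq ρ).pos
    have hm'pos : 0 < m' := by
      rcases Nat.eq_zero_or_pos m' with h | h
      · rw [h, mul_zero] at hm'; omega
      · exact h
    have hm'lt : m' < m := by
      have : 2 ≤ q ρ := (hq ρ).two_le
      nlinarith
    refine hmin m' hm'lt ⟨hm'pos, g', ?_⟩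
    have hqne : ((q ρ : ℕ) : F) ≠ 0 := by exact_mod_cast (hq ρ).ne_zero
    apply mul_left_cancel₀ hqne
    rw [Finset.mul_sum, ← mul_assoc, ← Nat.cast_mul, ← hm', hmγ]
    refine Finset.sum_congr rfl fun k _ ↦ ?_
    rw [hg' k]; push_cast; ring
  -- cubic residues: `Σ_i e_{ρ,i} d_i ≡ 0 (mod 3)`
  have hrel3 : ∀ ρ, (∑ i, (e ρ i : ZMod 3) * d i) = 0 := by
    intro ρ
    set x : ZMod (q ρ) := ∏ i, (∑ k : Fin 6, (b i k : ZMod (q ρ)) * r ρ 0 ^ (k : ℕ)) ^ (d i).val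
      with hx
    have hx0 : x ≠ 0 := Finset.prod_ne_zero_iff.mpr fun i _ ↦ pow_ne_zero _ (hnz ρ i)
    have h1 : x ^ ((q ρ - 1) / 3) = 1 :=
      pow_div_three_eq_one_of_zeta (hq27 ρ) (hqm ρ) hx0 (hr9 ρ 0) (htransfer ρ 0)
    have h2 : x ^ ((q ρ - 1) / 3) = ω ρ ^ (∑ i, e ρ i * (d i).val) := by
      rw [hx, ← Finset.prod_pow, ← Finset.prod_pow_eq_pow_sum]
      refine Finset.prod_congr rfl fun i _ ↦ ?_
      rw [← pow_mul, Nat.mul_comm ((d i).val) ((q ρ - 1) / 3), pow_mul, he ρ i, ← pow_mul]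
    rw [h2] at h1
    have h3 : 3 ∣ ∑ i, e ρ i * (d i).val :=
      KummerLayerClasses.three_dvd_of_pow_eq_one (hω ρ).1 (hω ρ).2 h1
    have h4 : ((∑ i, e ρ i * (d i).val : ℕ) : ZMod 3) = 0 := (ZMod.natCast_eq_zero_iff _ _).mpr h3
    push_cast at h4
    simpa only [ZMod.natCast_val, ZMod.cast_id', id_eq] using h4
  -- the left inverse finishes
  funext i
  calc d i = ∑ i', (if i = i' then 1 else 0) * d i' := by simp
    _ = ∑ i', (∑ ρ, (L i ρ : ZMod 3) * (e ρ i' : ZMod 3)) * d i' := by simp_rw [hL]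
    _ = ∑ ρ, (L i ρ : ZMod 3) * ∑ i', (e ρ i' : ZMod 3) * d i' := by
        simp_rw [Finset.mul_sum, Finset.sum_mul]
        rw [Finset.sum_comm]
        exact Finset.sum_congr rfl fun ρ _ ↦ Finset.sum_congr rfl fun i' _ ↦ by ring
    _ = 0 := by simp [hrel3]

end KummerLayerTwisted

end Summit.BirchSwinnertonDyer.Rank1Residual.Additive

end
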